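import Literature.AlgebraicGeometry.Frobenioids.Cor54SubBiratCompatProofs
import Literature.AlgebraicGeometry.Frobenioids.FrobenioidNatIso
import Literature.AlgebraicGeometry.Frobenioids.PreFrobenioidEquivalenceTransport
import Literature.AlgebraicGeometry.Frobenioids.ModelFrobenioidBirat
import HarnessLib

/-!
# Frobenioids I, Prop. 4.4 (iii) / Cor. 4.10: the rational-function subfunctor `Φ^birat` is INVARIANT under an
# equivalence of categories compatible with the structure functors to `F_Φ`

Mochizuki, *The geometry of Frobenioids I: the general theory*, Kyushu J. Math. **62** (2008) 293–400,
Prop. 4.4 (iii) p. 83 ("There exists a unique subfunctor of groups `Φ^birat ⊆ Φ^gp` such that the functor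
`C^birat → F_{Φ^gp}` of (i) factors through the subcategory `F_{Φ^birat} ⊆ F_{Φ^gp}` determined by `Φ^birat` …")
and Cor. 4.10 p. 91 ("there exists a 1-unique functor `Ψ^birat : C₁^birat → C₂^birat` …") [cite: MochizukiFrdI2008, Prop. 4.4 (iii) p.83].

PROOF-ONLY (cell abc-iut; seat abc-iut-w5-d137, W3 cutter — row C54/L03 `BiratCompat` of
`plan/L1/SUBDAG-FrdI-Prop53-Cor54.md` at `Ψ^Base = 𝟭`; written for the residual named by seat abc-iut-w5-d153 in
[IUTchIII] Prop. 3.7 (ii) junction J1: "invariance of L1's concrete `Φ^birat` (`biratSubfunctor`) under the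
comparison equivalence `Ffrak F ≌ FrakModel` — a generic [FrdI] Prop. 4.4 (iii) matter").
Layer L1 realises `Φ^birat` CONCRETELY (seat abc-iut-L1-t5, `PreFrobenioid.biratSubfunctor F`: the subgroups of
`Φ^gp` generated by the birational germs `Φ(δ₁)⁻¹Div δ₁ − Φ(δ₂)⁻¹Div δ₂` of base-equivalent co-angular pre-step pairs),
so it depends a priori on the category `C` and the structure functor `F : C → F_Φ`, not only on the equivalence
class of the pair.  Here: for two pre-Frobenioid structures `F₁ : C₁ → F_Φ`, `F₂ : C₂ → F_Φ` over the SAME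
divisorial, hence sharp, monoid `Φ` on `D`, an equivalence of categories `e : C₁ ≌ C₂` and an isomorphism of
structure functors `τ : e ⋙ F₂ ≅ F₁` (i.e. `e` is "compatible with the functors to `F_Φ`"),
**`PreFrobenioid.biratSubfunctor F₁ = PreFrobenioid.biratSubfunctor F₂`** (`biratSubfunctor_eq_of_equivalence`;
objectwise `biratSubgroup_eq_of_equivalence`).  Proof = seat abc-iut-w5-d221's C54/L03 closer
`FrdI.Cor54Sub.biratCompat_of` (generator chase, Cor. 4.10 over the Cor. 4.11 data) at the DEGENERATE Cor. 4.11 data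
`Ψ^Base := 𝟭 D`, `Ψ^Φ := identity`, `η :=` the base part of `τ`, with its inputs discharged by the transport
dictionaries: `Div(e φ) = Base(τ_A)^* Div φ` (seat abc-iut-L6-t9's `StructureIso.div_eq`), pre-steps / co-angular
pre-steps along `τ` (`StructureIso.isPreStep_iff` / `isCoAngularPreStep_iff`) and along the equivalence (seat
abc-iut-L6-t6's `isCoAngularPreStep_equivalence_iff`), for `e` and for `e⁻¹` (`τ' : e⁻¹ ⋙ F₁ ≅ F₂` from the counit).
No definitions; no statement of the paper is strengthened; nothing here bears on [IUTchIII] Cor. 3.12 beyond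
supplying this kernel-checked input by name (L1 = [FrdI], a refereed preparatory paper).
-/

noncomputable section

namespace Literature.AlgebraicGeometry.Frobenioids

open CategoryTheory Opposite Function

universe w v u v₁ u₁ v₂ u₂

namespace PreFrobenioid

variable {D : Type u} [Category.{v} D] {Φ : Dᵒᵖ ⥤ CommMonCat.{w}}
  {C₁ : Type u₁} [Category.{v₁} C₁] {C₂ : Type u₂} [Category.{v₂} C₂]
  {F₁ : C₁ ⥤ ElemFrobenioid Φ} {F₂ : C₂ ⥤ ElemFrobenioid Φ}

/-- For an equivalence `e : C₁ ≌ C₂` with `τ : e ⋙ F₂ ≅ F₁`, the induced `τ' : e⁻¹ ⋙ F₁ ≅ F₂` (through the counit).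
[cite: MochizukiFrdI2008, Cor. 4.10 p.91] -/
theorem nonempty_inverse_comp_iso (e : C₁ ≌ C₂) (τ : e.functor ⋙ F₂ ≅ F₁) : Nonempty (e.inverse ⋙ F₁ ≅ F₂) :=
  ⟨Functor.isoWhiskerLeft e.inverse τ.symm ≪≫ (Functor.associator _ _ _).symm ≪≫
    Functor.isoWhiskerRight e.counitIso F₂ ≪≫ F₂.leftUnitor⟩

/-- **`Φ^birat(X)` is invariant under an equivalence compatible with the structure functors** (objectwise form):
for pre-Frobenioid structures `F₁ : C₁ → F_Φ`, `F₂ : C₂ → F_Φ` over the same sharp `Φ`, `e : C₁ ≌ C₂` and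
`τ : e ⋙ F₂ ≅ F₁`, the subgroups `Φ^birat_{F₁}(X) = Φ^birat_{F₂}(X)` of `Φ(X)^gp` coincide for every `X ∈ Ob(D)` —
Cor. 4.10 / Prop. 4.4 (iii) through seat abc-iut-w5-d221's `FrdI.Cor54Sub.biratCompat_of` at `Ψ^Base = 𝟭`,
`Ψ^Φ = 1`. [cite: MochizukiFrdI2008, Prop. 4.4 (iii) p.83] -/
theorem biratSubgroup_eq_of_equivalence (e : C₁ ≌ C₂) (τ : e.functor ⋙ F₂ ≅ F₁)
    (hΦ : ∀ A : D, IsSharp (Φ.obj (op A))) (hF₁ : IsPreFrobenioid Φ F₁) (hF₂ : IsPreFrobenioid Φ F₂) (X : D) :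
    biratSubgroup F₁ X = biratSubgroup F₂ X := by
  obtain ⟨τ'⟩ := nonempty_inverse_comp_iso e τ
  -- the degenerate Cor. 4.11 data: `Ψ^Base = 𝟭`, `Ψ^Φ = 1`, `η` = base part of `τ`
  let E : PreFrobenioidData.DivisorMonoidIsoOverBase
      (PreFrobenioidData.ofFunctor Φ F₁) (PreFrobenioidData.ofFunctor Φ F₂) (𝟭 D) :=
    { iso := fun X => MulEquiv.refl _
      natural := fun _ _ f x => rfl }
  let η : e.functor ⋙ (PreFrobenioidData.ofFunctor Φ F₂).base ≅ (PreFrobenioidData.ofFunctor Φ F₁).base ⋙ 𝟭 D :=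
    NatIso.ofComponents (fun A => (ElemFrobenioid.baseFunctor Φ).mapIso (τ.app A)) (by
      intro A B φ
      have h := congrArg (ElemFrobenioid.baseFunctor Φ).map (τ.hom.naturality φ)
      rw [Functor.map_comp, Functor.map_comp] at h
      exact h)
  have hη : ∀ A : C₁, η.hom.app A = ElemFrobenioid.Base (τ.hom.app A) := fun A => rfl
  -- Div-compatibility: `Div_{F₂}(e φ) = Base(τ_A)^* Div_{F₁}(φ)`
  have hdiv : ∀ ⦃A B : C₁⦄ (φ : A ⟶ B),
      (PreFrobenioidData.ofFunctor Φ F₂).div (e.functor.map φ) =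
        (PreFrobenioidData.ofFunctor Φ F₂).pull (η.hom.app A)
          (E.iso ((PreFrobenioidData.ofFunctor Φ F₁).base.obj A) ((PreFrobenioidData.ofFunctor Φ F₁).div φ)) := by
    intro A B φ
    rw [hη]
    exact StructureIso.div_eq τ.symm hΦ φ
  -- pre-steps and co-angular pre-steps along `e` (via `τ`) and along `e⁻¹` (via `τ'`)
  have hpre : PreFrobenioidData.PreservesMor e.functor (PreFrobenioidData.ofFunctor Φ F₁).IsPreStep
      (PreFrobenioidData.ofFunctor Φ F₂).IsPreStep := fun A B φ h =>
    (PreFrobenioidData.ofFunctor_isPreStep F₂ _).mpr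
      ((StructureIso.isPreStep_iff τ.symm φ).mpr ((PreFrobenioidData.ofFunctor_isPreStep F₁ φ).mp h))
  have hco : PreFrobenioidData.PreservesMor e.functor (PreFrobenioidData.ofFunctor Φ F₁).IsCoAngularPreStep
      (PreFrobenioidData.ofFunctor Φ F₂).IsCoAngularPreStep := by
    intro A B φ h
    have h₁ : IsCoAngularPreStep F₁ φ :=
      ⟨(PreFrobenioidData.ofFunctor_isCoAngular F₁ φ).mp h.1, (PreFrobenioidData.ofFunctor_isPreStep F₁ φ).mp h.2⟩
    have h₂ : IsCoAngularPreStep F₂ (e.functor.map φ) :=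
      (isCoAngularPreStep_equivalence_iff e hF₂ φ).mp ((StructureIso.isCoAngularPreStep_iff τ.symm hΦ φ).mpr h₁)
    exact ⟨(PreFrobenioidData.ofFunctor_isCoAngular F₂ _).mpr h₂.1, (PreFrobenioidData.ofFunctor_isPreStep F₂ _).mpr h₂.2⟩
  have hpre' : PreFrobenioidData.PreservesMor e.inverse (PreFrobenioidData.ofFunctor Φ F₂).IsPreStep
      (PreFrobenioidData.ofFunctor Φ F₁).IsPreStep := fun A B ψ h =>
    (PreFrobenioidData.ofFunctor_isPreStep F₁ _).mpr
      ((StructureIso.isPreStep_iff τ' ψ).mp ((PreFrobenioidData.ofFunctor_isPreStep F₂ ψ).mp h))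
  have hco' : PreFrobenioidData.PreservesMor e.inverse (PreFrobenioidData.ofFunctor Φ F₂).IsCoAngularPreStep
      (PreFrobenioidData.ofFunctor Φ F₁).IsCoAngularPreStep := by
    intro A B ψ h
    have h₁ : IsCoAngularPreStep F₂ ψ :=
      ⟨(PreFrobenioidData.ofFunctor_isCoAngular F₂ ψ).mp h.1, (PreFrobenioidData.ofFunctor_isPreStep F₂ ψ).mp h.2⟩
    have h₂ : IsCoAngularPreStep F₁ (e.inverse.map ψ) :=
      (isCoAngularPreStep_equivalence_iff e.symm hF₁ ψ).mp ((StructureIso.isCoAngularPreStep_iff τ' hΦ ψ).mp h₁)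
    exact ⟨(PreFrobenioidData.ofFunctor_isCoAngular F₁ _).mpr h₂.1, (PreFrobenioidData.ofFunctor_isPreStep F₁ _).mpr h₂.2⟩
  -- Cor. 4.10 at the degenerate data
  have hc := FrdI.Cor54Sub.biratCompat_of F₁ F₂ e hF₂ (𝟭 D) E η hdiv hpre hco hpre' hco' X
  -- `Ψ^Φ = 1` acts as the identity on `Φ(X)^gp`
  have hf : ∀ c : Algebra.GrothendieckGroup (Φ.obj (op X)), MonGp.map (E.iso X).toMonoidHom c = c := by
    intro c
    show MonGp.map (MonoidHom.id (Φ.obj (op X))) c = c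
    rw [MonGp.map_id]
    rfl
  have hc' : (biratSubgroup F₁ X).map (MonGp.map (E.iso X).toMonoidHom) = biratSubgroup F₂ X := hc
  rw [← hc']
  ext c
  constructor
  · exact fun h => Subgroup.mem_map.mpr ⟨c, h, hf c⟩
  · intro h
    obtain ⟨x, hx, hxc⟩ := Subgroup.mem_map.mp h
    have hcx : c = x := hxc.symm.trans (hf x)
    rw [hcx]
    exact hx

/-- **`Φ^birat` is invariant under an equivalence compatible with the structure functors** ([FrdI] Prop. 4.4
(iii) "a unique subfunctor of groups `Φ^birat ⊆ Φ^gp`" / Cor. 4.10, for L1's CONCRETE `biratSubfunctor`): for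
pre-Frobenioid structures `F₁ : C₁ → F_Φ`, `F₂ : C₂ → F_Φ` over the same sharp `Φ`, an equivalence `e : C₁ ≌ C₂` and an
isomorphism `τ : e ⋙ F₂ ≅ F₁`, `biratSubfunctor F₁ = biratSubfunctor F₂`. [cite: MochizukiFrdI2008, Prop. 4.4 (iii) p.83] -/
theorem biratSubfunctor_eq_of_equivalence (e : C₁ ≌ C₂) (τ : e.functor ⋙ F₂ ≅ F₁)
    (hΦ : ∀ A : D, IsSharp (Φ.obj (op A))) (hF₁ : IsPreFrobenioid Φ F₁) (hF₂ : IsPreFrobenioid Φ F₂) :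
    biratSubfunctor F₁ = biratSubfunctor F₂ :=
  GpSubfunctor.ext_carrier (funext fun X => biratSubgroup_eq_of_equivalence e τ hΦ hF₁ hF₂ X)

/-- The same along an isomorphism of structure functors on ONE category (`e = 𝟭`): `Φ^birat` depends only on the
isomorphism class of `F : C → F_Φ`. [cite: MochizukiFrdI2008, Prop. 4.4 (iii) p.83] -/
theorem biratSubfunctor_eq_of_iso {F F' : C₁ ⥤ ElemFrobenioid Φ} (τ : F ≅ F')
    (hΦ : ∀ A : D, IsSharp (Φ.obj (op A))) (hF : IsPreFrobenioid Φ F) :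
    biratSubfunctor F' = biratSubfunctor F :=
  biratSubfunctor_eq_of_equivalence (F₁ := F') (F₂ := F) (CategoryTheory.Equivalence.refl (C := C₁))
    (F.leftUnitor ≪≫ τ) hΦ
    (IsPreFrobenioid.of_natIso τ hF) hF

end PreFrobenioid

end Literature.AlgebraicGeometry.Frobenioids

end
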